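import Summits.KontsevichZagierPeriods.KontsevichZagierPeriods.Statement
import Summits.KontsevichZagierPeriods.KontsevichZagierPeriods.Theses.TorsionLogs
import Literature.NumberTheory.Transcendental.KZKernelConjectureForms
import Mathlib

/-!
# F4 ON-PATH LEMMA for the rung `NeronTorsionArgument` (line `NeronTorsionArgument` on crux `TorsionSectorComplete`,
# stmt-KontsevichZagierPeriods-14212; forward generator G1 `next-rung`, gen 15, seed g1-KontsevichZagierPeriods-17981)

`theorem onPath : KontsevichZagierPeriods → NeronTorsionArgument` — the summit implies the rung.  Member `false` (the floor,
a real torsion point) is a theorem outright (`Theses.TorsionLogs.NeronTorsionPrimitiveChain_holds`); member `true` (the tied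
Néron ARGUMENT sector: imaginary part of the complex Néron triangle at a non-real torsion point, π-, arctangent- and
`W₀η₁`-carriers) follows from Conjecture 1 in kernel form (`kzKernelConjecture_iff_isRational`): the element evaluates, by
`KZ.eval_of`, to the value hypothesis, hence lies in `ker eval = relations`.  No `sorry`.  Self-contained: verbatim copies
of the three `def`s of `Lines/NeronTorsionArgument.lean` in the namespace `…NeronTorsionArgument.OnPath`; the `@[simp]`
hypothesis-form theorem is the shape the tribunal's forward probe `S → Rung` closes with (`intro h; aesop`).
[cite: KontsevichZagier2001, §1.2] [cite: Lang1983, Ch. 18 §1]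
-/

noncomputable section

-- `Summit.KontsevichZagierPeriods.KontsevichZagierPeriods.…` is the tree's mandated layout (single-conjunct summit).
set_option linter.dupNamespace false

namespace Summit.KontsevichZagierPeriods.KontsevichZagierPeriods.Cruxes.TorsionSectorComplete.NeronTorsionArgument.OnPath

open Literature.NumberTheory.Transcendental
open Summit.KontsevichZagierPeriods.KontsevichZagierPeriods.Theses.TorsionLogs (NeronTorsionPrimitiveChain
  NeronTorsionPrimitiveChain_holds)

/-- Verbatim copy of `Lines/NeronTorsionArgument.lean :: NeronArgumentSector` (member `true`). **Member `true`: the TIED NÉRON ARGUMENT SECTOR.**  Data (gen 8's complex-torsion data verbatim): a real Weierstrass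
curve `y² = f(x) = 4x³ − g₂x − g₃`, `g₂³ ≠ 27g₃²`, roots `e₂ < e₁`, `0 < e₁`, `f > 0` beyond `e₁`, `f < 0` on `(e₂, e₁)`; a
NON-REAL point `P = (x_P, y_P)`, `Im x_P ≠ 0`; the continuous branch `y_c` of `y` along `x(s) = e₁ + s(x_P − e₁)`,
`y_c(1) = y_P`; the complex lattice datum `N·(ω₁/2 + ∫₀¹ (x_P−e₁) ds/y_c) = a·ω₁ + b·(2iW₀)`, `0 < 2a < N`, `0 < 2b < N`
(principal lift; it makes `P` an `N`-torsion point).  Representations pinned: `rJ = [0<s'<s<1, Im((x_P−e₁)² x(s')/(y_c(s')y_c(s)))]`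
(IMAGINARY part of the complex Néron triangle), `rW = [(e₂,e₁)×(e₁,∞), (1/√(−f(x)))·(g₂x'+2g₃)/(2x'²√f(x'))]` (value `W₀η₁`),
`rD = [ℝ, dt/(1+t²)]` (value `π`), `rA = [0<t<γ, dt/(1+t²)]` (value `arctan γ`).  Tie `N²k₁ + M(N−2a)b = 0`; `k₂, m` free;
VALUE HYPOTHESIS `M·rJ + k₁·rW + k₂·rD = m·rA`.  CLAIM: `M•[rJ] + k₁•[rW] + k₂•[rD] − m•[rA] ∈ KZ.relations`.
[cite: KontsevichZagier2001, §1.2] [cite: Lang1983, Ch. 18 §1] -/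
def NeronArgumentSector : Prop :=
  ∀ (g₂ g₃ e₁ e₂ γ : ℝ) (xP yP : ℂ) (yc : ℝ → ℂ) (N a b : ℕ) (M k₁ k₂ m : ℤ) (f : ℝ → ℝ),
    (∀ x, f x = 4 * x ^ 3 - g₂ * x - g₃) → g₂ ^ 3 - 27 * g₃ ^ 2 ≠ 0 → f e₁ = 0 → f e₂ = 0 → e₂ < e₁ → 0 < e₁ →
    (∀ x, e₁ < x → 0 < f x) → (∀ x, e₂ < x → x < e₁ → f x < 0) → xP.im ≠ 0 →
    yP ^ 2 = 4 * xP ^ 3 - (g₂ : ℂ) * xP - (g₃ : ℂ) → ContinuousOn yc (Set.Icc 0 1) → yc 1 = yP →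
    (∀ s ∈ Set.Icc (0 : ℝ) 1,
      yc s ^ 2 = 4 * ((e₁ : ℂ) + (s : ℂ) * (xP - e₁)) ^ 3 - (g₂ : ℂ) * ((e₁ : ℂ) + (s : ℂ) * (xP - e₁)) - (g₃ : ℂ)) →
    (∀ s ∈ Set.Ioc (0 : ℝ) 1, yc s ≠ 0) → 3 ≤ N → 0 < a → 2 * a < N → 0 < b → 2 * b < N →
    (N : ℂ) * (((∫ x in Set.Ioi e₁, (Real.sqrt (f x))⁻¹ : ℝ) : ℂ) + ∫ s in Set.Ioo (0 : ℝ) 1, (xP - e₁) / yc s) =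
      (a : ℂ) * (((2 * ∫ x in Set.Ioi e₁, (Real.sqrt (f x))⁻¹ : ℝ) : ℂ)) +
        (b : ℂ) * (((2 * ∫ x in Set.Ioo e₂ e₁, (Real.sqrt (-f x))⁻¹ : ℝ) : ℂ)) * Complex.I →
    (N : ℤ) ^ 2 * k₁ + M * ((N : ℤ) - 2 * (a : ℤ)) * (b : ℤ) = 0 → 0 < γ →
    ∀ (rJ rW : KZ.IntegralRep 2) (rD rA : KZ.IntegralRep 1),
    rJ.domain = {z | 0 < z 1 ∧ z 1 < z 0 ∧ z 0 < 1} →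
    Set.EqOn rJ.integrand
      (fun z => ((xP - e₁) ^ 2 * ((e₁ : ℂ) + ((z 1 : ℝ) : ℂ) * (xP - e₁)) / (yc (z 1) * yc (z 0))).im) rJ.domain →
    rW.domain = {z | e₂ < z 0 ∧ z 0 < e₁ ∧ e₁ < z 1} →
    Set.EqOn rW.integrand
      (fun z => (Real.sqrt (-f (z 0)))⁻¹ * ((g₂ * z 1 + 2 * g₃) / (2 * (z 1) ^ 2 * Real.sqrt (f (z 1))))) rW.domain →
    rD.domain = Set.univ → Set.EqOn rD.integrand (fun t => (1 + t 0 ^ 2)⁻¹) rD.domain →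
    rA.domain = {t | 0 < t 0 ∧ t 0 < γ} → Set.EqOn rA.integrand (fun t => (1 + t 0 ^ 2)⁻¹) rA.domain →
    (M : ℝ) * rJ.value + k₁ * rW.value + k₂ * rD.value = m * rA.value →
    M • KZ.of rJ + k₁ • KZ.of rW + k₂ • KZ.of rD - m • KZ.of rA ∈ KZ.relations

/-- Verbatim copy of `Lines/NeronTorsionArgument.lean :: NeronArgumentMember`. **The family, graded by the projection read (`false` ↦ real torsion point, real value — the floor; `true` ↦ non-real
torsion point, IMAGINARY part).**  Member `false` is the floor decl `Theses.TorsionLogs.NeronTorsionPrimitiveChain` VERBATIM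
(the seed, CLOSED); member `true` is `NeronArgumentSector`. -/
def NeronArgumentMember : Bool → Prop
  | false => NeronTorsionPrimitiveChain
  | true => NeronArgumentSector

/-- Verbatim copy of `Lines/NeronTorsionArgument.lean :: NeronTorsionArgument` (THE RUNG). **THE RUNG `NeronTorsionArgument`: both members.** `∀ b, NeronArgumentMember b` — the proved floor and the new argument
sector statement. -/
def NeronTorsionArgument : Prop := ∀ imaginary : Bool, NeronArgumentMember imaginary

/-- **The summit implies the new member** (Conjecture 1, kernel form). -/
@[simp] theorem argumentSector_of_kontsevichZagierPeriods (h : _root_.KontsevichZagierPeriods) :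
    NeronArgumentSector := by
  have hK : KZKernelConjecture := kzKernelConjecture_iff_isRational.mpr h
  intro g₂ g₃ e₁ e₂ γ xP yP yc N a b M k₁ k₂ m f _ _ _ _ _ _ _ _ _ _ _ _ _ _ _ _ _ _ _ _ _ _ rJ rW rD rA _ _ _ _ _ _ _ _
    hval
  apply hK
  simp only [map_sub, map_add, map_zsmul, KZ.eval_of, zsmul_eq_mul]
  linear_combination hval

/-- **F4 ON-PATH (hypothesis form, `@[simp]`): the summit implies the rung.** -/
@[simp] theorem neronTorsionArgument_of_kontsevichZagierPeriods (h : _root_.KontsevichZagierPeriods) :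
    NeronTorsionArgument := by
  rintro (_ | _)
  · exact NeronTorsionPrimitiveChain_holds
  · exact argumentSector_of_kontsevichZagierPeriods h

/-- **F4 ON-PATH LEMMA** in the literal shape `S → Rung`. -/
theorem onPath : _root_.KontsevichZagierPeriods → NeronTorsionArgument :=
  neronTorsionArgument_of_kontsevichZagierPeriods

/-- The forward probe's own tactic closes `S → Rung` against this file. -/
example : _root_.KontsevichZagierPeriods → NeronTorsionArgument := by
  intro h; aesop

end Summit.KontsevichZagierPeriods.KontsevichZagierPeriods.Cruxes.TorsionSectorComplete.NeronTorsionArgument.OnPath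

end
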